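import Summits.Ventures.CertifiedManyBodySolver.Rows.CorrWindowCertKernelForm
import Summits.Ventures.CertifiedManyBodySolver.Rows.CARPolyWindowGramTwoLevel
import HarnessLib

/-!
# KERNEL FORM of the `t–t'` window-certificate soundness with an ABSTRACT GRAM SLOT — and its TWO-LEVEL (symmetry-adapted) instance

HONEST FRAMING: Lean plumbing towards «tier P» (an SDP vertex certificate becoming a kernel theorem), the sequel of
`Rows/CorrWindowCertKernelForm.lean` requested by the sizing replay of the D-0150 box's CORE program (HOME/STATUS «LA214-TIERP-UPRIME
U1»): the kernel theorem there hard-wires the SOS-FACTOR Gram shape `gramT K Q`; a symmetry-adapted certificate of CORE size is two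
orders of magnitude cheaper to replay in the TWO-LEVEL shape `gramTB K blocks` of `Rows/CARPolyWindowGramTwoLevel.lean`. This file
states the kernel theorem ONCE for an abstract Gram term list `TG` with a semantic certificate `termOp d TG = gramForm Λ O`, `Λ ⪰ 0`
(`affineOrbitLowerRowN_of_kernelCertG`), recovers the factor form as the definitional special case (`residT_eq_residTG`), and
instantiates the two-level form (`affineOrbitLowerRowN_of_kernelCertTB`: PSD by construction, so the ONLY per-certificate obligation
is again ONE decidable rational inequality). It does NOT discharge any existing claim node; no number of record moves; the rows are
CONTROL/CALIBRATION stiffness-scale CEILINGS (wording (xx1)), silent on the presence of superconductivity; not a `T_c` or phase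
sentence; nothing about any material; no summit statement is proved by this file. Seat hubbard-obs-p2 (STIFFNESS),
`prover-hubbard-obs-p2-g22-0`, zero compute.

THE STATEMENTS. Data and dictionary hypotheses exactly as in `affineOrbitLowerRowN_of_kernelCert` (module docstring of
`Rows/CorrWindowCertKernelForm.lean`), except that the Gram family is an arbitrary term list `TG` together with
`(hΛm : Λ.PosSemidef) (O : m → 𝔄_{Λ'}) (hTG : termOp d TG = gramForm Λ O)`; the residual is
`residTG = TX − Σ_σ μ_σ (n_{0σ} − ν) − κhi (hi − TE) − κlo (TE − lo) − TG − eomTβ − symT − CW − ahT` and the conclusion is the affine-N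
claim-node predicate `SquareTTPrimeCorrAffineOrbitLowerRowN tp U q hi lo κhi κlo s n₀ S Λ' (termOp d TX)` from the ONE inequality
`q ≤ lowerConst (normalize enc B residTG) + (μ 0 + μ 1)(n₀/2 − ν)`. Instances: `TG := gramT K Q` (`Λ = 1`, `Oᵢ = 2^{−K} termOp qᵢ`;
`residT = residTG` by `rfl`) and `TG := gramTB K blocks` (`Λ = gramTBCoef K blocks = F Fᴴ`, `O = gramTBOp d blocks`,
`termOp_gramTB_eq_gramForm`, `gramTBCoef_posSemidef`).

References: J. Wang et al., PRX 14 (2024) 031006 §III [WangEtAl2024]; X. Han, arXiv:2006.06002 §2–§3 [Han2020Bootstrap]; C. Jansson,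
D. Chaykin, C. Keil, SIAM J. Numer. Anal. 46 (2008) 180 [JanssonChaykinKeil2008].
-/

noncomputable section

namespace Summit.Ventures.CertifiedManyBodySolver

namespace CARPolyWindow

open Summit.Ventures.CertifiedQuantumChemistry Summit.Ventures.CertifiedQuantumChemistry.CARPoly
open Literature.MathematicalPhysics.QuantumLattice Literature.MathematicalPhysics.QuantumLattice.HubbardWave0
open Literature.MathematicalPhysics.QuantumManyBody.StateRelaxation
open Literature.Probability.LatticeModels ThermodynamicLimit Filter Topology
open Matrix
open scoped ComplexOrder BigOperators

/-! ## The residual with an abstract Gram slot -/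

section Residual

variable {α β : Type*}

/-- **The RESIDUAL term list of a window certificate with an ABSTRACT Gram term list `TG`**: objective minus density rows minus
energy rows minus `TG` minus eom minus symmetry identifications minus charged words minus anti-Hermitian parts.
[cite: WangEtAl2024, §III] -/
def residTG (TX : Terms α) (μ : Fin 2 → ℚ) (ν : ℚ) (o : Fin 2 → α) (κhi hi κlo lo : ℚ) (TE : Terms α)
    (TG : Terms α) (TH : Terms α) (f : β → α) (EB : List (Terms β))
    {nS : ℕ} (g : Fin nS → β → α) (SY : Fin nS → Terms β) (CW : Terms α) (AV : List (Terms α)) : Terms α :=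
  TX ++ negT ((finL 2).flatMap fun σ => scaleT (μ σ) (densT o ν σ))
    ++ negT (scaleT κhi (unitT hi ++ negT TE)) ++ negT (scaleT κlo (TE ++ unitT (-lo)))
    ++ negT TG ++ negT (eomTβ TH f EB) ++ negT (symT f g SY) ++ negT CW ++ negT (ahT AV)

/-- The SOS-factor residual `residT` IS `residTG` with `TG := gramT K Q` (definitionally). [cite: Han2020Bootstrap, §2 eq. (2)] -/
theorem residT_eq_residTG (TX : Terms α) (μ : Fin 2 → ℚ) (ν : ℚ) (o : Fin 2 → α) (κhi hi κlo lo : ℚ) (TE : Terms α)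
    (K : ℕ) (Q : List (Terms α)) (TH : Terms α) (f : β → α) (EB : List (Terms β))
    {nS : ℕ} (g : Fin nS → β → α) (SY : Fin nS → Terms β) (CW : Terms α) (AV : List (Terms α)) :
    residT TX μ ν o κhi hi κlo lo TE K Q TH f EB g SY CW AV = residTG TX μ ν o κhi hi κlo lo TE (gramT K Q) TH f EB g SY CW AV :=
  rfl

end Residual

/-! ## The kernel form with an abstract Gram slot -/

section KernelForm

variable {α β : Type*} [LinearOrder α]

/-- **KERNEL FORM, ABSTRACT GRAM SLOT: syntactic window certificate whose Gram family is any term list `TG` denoting a `gramForm Λ O`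
with `Λ ⪰ 0` + `q ≤ lowerConst (normalize residTG) + (Σμ)(n₀/2 − ν)` ⇒ the affine-N claim-node predicate**
`SquareTTPrimeCorrAffineOrbitLowerRowN tp U q hi lo κhi κlo s n₀ S Λ' (termOp d TX)`. [cite: WangEtAl2024, §III]
[cite: JanssonChaykinKeil2008, §3] -/
theorem affineOrbitLowerRowN_of_kernelCertG
    (tp U : ℚ) (hU : 0 ≤ U)
    {Λ Λ' : Finset (Site 2)} (hΛ : Λ ⊆ Λ') (h8 : thicken Λ 1 ⊆ Λ')
    (h0 : thicken ({0} : Finset (Site 2)) 1 ⊆ Λ') (hz : (0 : Site 2) ∈ Λ')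
    {S : Finset (DihedralGroup 4)} (h1 : (1 : DihedralGroup 4) ∈ S) (hmul : ∀ a ∈ S, ∀ b ∈ S, a * b ∈ S)
    -- letters
    (d : α → Orb (PolySite Λ')) (hd : Function.Injective d) (enc : α → ℕ) (Bkey : ℕ)
    (dΛ : β → Orb (PolySite Λ)) (f : β → α) (hf : ∀ b, d (f b) = Orb.embMap (PolySite.incl hΛ) (dΛ b))
    (sp : α → Fin 2) (hsp : ∀ a, (ofLex (d a)).2 = sp a)
    -- dictionaries
    (TH : Terms α) (hH : termOp d TH = (hubbardTTPrimeFermionInteraction 1 tp U).localHamiltonian Λ')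
    (TE : Terms α)
    (hE : termOp d TE = fermionEmbed (PolySite.incl h0) ((hubbardTTPrimeFermionInteraction 1 tp U).meanEnergyObs 1))
    (o : Fin 2 → α) (ho : ∀ σ, d (o σ) = orb (PolySite.pt 0 hz) σ)
    -- certificate data
    (TX : Terms α) (μ : Fin 2 → ℚ) (ν κhi hi κlo lo : ℚ)
    (TG : Terms α) {m : Type*} [Fintype m] [DecidableEq m] {Λm : Matrix m m ℂ} (hΛm : Λm.PosSemidef)
    (O : m → FermionOp Λ') (hTG : termOp d TG = gramForm Λm O) (EB : List (Terms β))
    {nS : ℕ} (γ : Fin nS → DihedralGroup 4) (hγS : ∀ l, γ l ∈ S) (wv : Fin nS → Site 2)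
    (hsh : ∀ l, d4ShiftSet (γ l) (wv l) Λ ⊆ Λ') (g : Fin nS → β → α)
    (hg : ∀ l b, d (g l b) = Orb.embMap (PolySite.incl (hsh l)) (Orb.embMap (PolySite.d4Emb (γ l) (wv l) Λ) (dΛ b)))
    (SY : Fin nS → Terms β)
    (CW : Terms α) (hcw : ∀ wc ∈ CW, chargeW wc.1 ≠ 0 ∨ spinChargeW sp wc.1 ≠ 0)
    (AV : List (Terms α))
    -- the ONE rational inequality
    {q s n₀ : ℚ} (hs : s = (μ 0 + μ 1) / 2)
    (hq : q ≤ lowerConst (CARPoly.normalize enc Bkey (residTG TX μ ν o κhi hi κlo lo TE TG TH f EB g SY CW AV)) +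
      (μ 0 + μ 1) * (n₀ / 2 - ν)) :
    SquareTTPrimeCorrAffineOrbitLowerRowN (tp : ℝ) (U : ℝ) q hi lo κhi κlo s n₀ S Λ' (termOp d TX) := by
  intro x hx0 hx2 ω Ls ψ hLs hψ hψ1 hω
  -- names
  set R : CARPoly.Poly α := CARPoly.normalize enc Bkey (residTG TX μ ν o κhi hi κlo lo TE TG TH f EB g SY CW AV) with hR
  set HΛ' : FermionOp Λ' := (hubbardTTPrimeFermionInteraction 1 (tp : ℝ) (U : ℝ)).localHamiltonian Λ' with hHΛ'
  set EΦ : FermionOp Λ' := fermionEmbed (PolySite.incl h0) ((hubbardTTPrimeFermionInteraction 1 (tp : ℝ) (U : ℝ)).meanEnergyObs 1)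
    with hEΦ
  set Bsem : Fin EB.length → FermionOp Λ := fun k => termOp dΛ (EB.get k) with hBsem
  set Ysem : Fin nS → FermionOp Λ := fun l => termOp dΛ (SY l) with hYsem
  set Vsem : Fin AV.length → FermionOp Λ' := fun m => termOp d (AV.get m) with hVsem
  set cwsem : Fin CW.length → List (Orb (PolySite Λ') × Bool) := fun j => wmap d (CW.get j).1 with hcwsem
  set bsem : Fin CW.length → ℂ := fun j => (((CW.get j).2 : ℚ) : ℂ) with hbsem
  -- the semantic pieces
  set Dn : FermionOp Λ' := ∑ σ : Fin 2, ((((μ σ : ℚ) : ℝ) : ℝ) : ℂ) • (nAt 0 hz σ - ((((ν : ℚ) : ℝ) : ℝ) : ℂ) • (1 : FermionOp Λ'))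
    with hDn
  set Er : FermionOp Λ' := ((((κhi : ℚ) : ℝ) : ℝ) : ℂ) • (((((hi : ℚ) : ℝ) : ℝ) : ℂ) • (1 : FermionOp Λ') - EΦ) +
      ((((κlo : ℚ) : ℝ) : ℝ) : ℂ) • (EΦ - ((((lo : ℚ) : ℝ) : ℝ) : ℂ) • (1 : FermionOp Λ')) with hEr
  set G : FermionOp Λ' := gramForm Λm O with hG
  set EOM : FermionOp Λ' := ∑ k ∈ (Finset.univ : Finset (Fin EB.length)),
      (HΛ' * fermionEmbed (PolySite.incl hΛ) (Bsem k) - fermionEmbed (PolySite.incl hΛ) (Bsem k) * HΛ') with hEOM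
  set SYM : FermionOp Λ' := ∑ l ∈ (Finset.univ : Finset (Fin nS)),
      (fermionEmbed (PolySite.incl (hsh l)) (fermionEmbed (PolySite.d4Emb (γ l) (wv l) Λ) (Ysem l)) -
        fermionEmbed (PolySite.incl hΛ) (Ysem l)) with hSYM
  set CHG : FermionOp Λ' := ∑ j ∈ (Finset.univ : Finset (Fin CW.length)), bsem j • ladderWord (cwsem j) with hCHG
  set AH : FermionOp Λ' := ∑ m ∈ (Finset.univ : Finset (Fin AV.length)), (((1 : ℝ) : ℝ) : ℂ) • ((Vsem m)ᴴ - Vsem m)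
    with hAH
  set RES : FermionOp Λ' := ∑ k ∈ (Finset.univ : Finset (Fin R.length)), resCoeff R k • ladderWord (resWord d R k) with hRES
  -- casts
  have ec : ∀ r : ℚ, ((((r : ℚ) : ℝ) : ℝ) : ℂ) = ((r : ℚ) : ℂ) := fun r => Complex.ofReal_ratCast r
  -- (1) what the residual denotes
  have key : termOp d (residTG TX μ ν o κhi hi κlo lo TE TG TH f EB g SY CW AV) =
      termOp d TX - Dn - Er - G - EOM - SYM - CHG - AH := by
    have hD : termOp d ((finL 2).flatMap fun σ => scaleT (μ σ) (densT o ν σ)) = Dn := by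
      rw [termOp_flatMap_finL, hDn]
      refine Finset.sum_congr rfl fun σ _ => ?_
      rw [termOp_scaleT, termOp_densT d hz o ho, ec, ec]
    have hEr' : termOp d (scaleT κhi (unitT hi ++ negT TE)) + termOp d (scaleT κlo (TE ++ unitT (-lo))) = Er := by
      rw [termOp_scaleT, termOp_scaleT, termOp_append, termOp_append, termOp_negT, termOp_unitT, termOp_unitT, hE,
        hEr, ec, ec, ec, ec, Rat.cast_neg, neg_smul, ← sub_eq_add_neg, ← sub_eq_add_neg]
    have hGr : termOp d TG = G := by rw [hG, hTG]
    have hEo : termOp d (eomTβ TH f EB) = EOM := by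
      rw [termOp_eomTβ hΛ d dΛ f hf, hH, hEOM]
    have hSy : termOp d (symT f g SY) = SYM := by
      rw [termOp_symT hΛ d dΛ f hf γ wv hsh g hg, hSYM]
    have hCh : termOp d CW = CHG := by rw [termOp_eq_sum_get, hCHG]
    have hAh : termOp d (ahT AV) = AH := by rw [termOp_ahT, hAH]
    rw [residTG, termOp_append, termOp_append, termOp_append, termOp_append, termOp_append, termOp_append, termOp_append,
      termOp_append, termOp_negT, termOp_negT, termOp_negT, termOp_negT, termOp_negT, termOp_negT, termOp_negT, termOp_negT,
      hD, hGr, hEo, hSy, hCh, hAh, ← hEr']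
    abel
  -- (2) the collected normal form denotes the same operator and splits into constant + residual family
  have hsplit : termOp d TX - Dn - Er - G - EOM - SYM - CHG - AH =
      ((((constCoeff R : ℚ) : ℝ) : ℝ) : ℂ) • (1 : FermionOp Λ') + RES := by
    rw [← key, ← evalPoly_normalize' hd enc Bkey, ← hR, ec, hRES]
    exact evalPoly_eq_const_add_residual d R
  -- (3) the tree's identity `hcert`, with `c := constCoeff R` and the residual family of `R`
  have hcert : termOp d TX - ((((constCoeff R : ℚ) : ℝ) : ℝ) : ℂ) • (1 : FermionOp Λ') -
        ∑ σ : Fin 2, ((((μ σ : ℚ) : ℝ) : ℝ) : ℂ) • (nAt 0 hz σ - ((((ν : ℚ) : ℝ) : ℝ) : ℂ) • (1 : FermionOp Λ')) -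
        ((((κhi : ℚ) : ℝ) : ℝ) : ℂ) • (((((hi : ℚ) : ℝ) : ℝ) : ℂ) • (1 : FermionOp Λ') - EΦ) -
        ((((κlo : ℚ) : ℝ) : ℝ) : ℂ) • (EΦ - ((((lo : ℚ) : ℝ) : ℝ) : ℂ) • (1 : FermionOp Λ')) =
      G + (EOM + SYM + CHG) + (AH + RES) := by
    rw [← hDn]
    rw [← sub_eq_zero]
    have e : termOp d TX - ((((constCoeff R : ℚ) : ℝ) : ℝ) : ℂ) • (1 : FermionOp Λ') - Dn -
          ((((κhi : ℚ) : ℝ) : ℝ) : ℂ) • (((((hi : ℚ) : ℝ) : ℝ) : ℂ) • (1 : FermionOp Λ') - EΦ) -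
          ((((κlo : ℚ) : ℝ) : ℝ) : ℂ) • (EΦ - ((((lo : ℚ) : ℝ) : ℝ) : ℂ) • (1 : FermionOp Λ')) -
          (G + (EOM + SYM + CHG) + (AH + RES)) =
        (termOp d TX - Dn - Er - G - EOM - SYM - CHG - AH) -
          (((((constCoeff R : ℚ) : ℝ) : ℝ) : ℂ) • (1 : FermionOp Λ') + RES) := by
      rw [hEr]; abel
    rw [e, hsplit, sub_self]
  -- (4) the charged words are charged
  have hcw' : ∀ j ∈ (Finset.univ : Finset (Fin CW.length)), ladderCharge (cwsem j) ≠ 0 ∨ ladderSpinCharge (cwsem j) ≠ 0 := by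
    intro j _
    rw [hcwsem]
    dsimp only
    rw [ladderCharge_wmap, ladderSpinCharge_wmap d sp hsp]
    exact hcw _ (List.get_mem CW j)
  -- (5) the Literature affine edge
  have hUr : (0 : ℝ) ≤ ((U : ℚ) : ℝ) := by exact_mod_cast hU
  have hmain := hω.re_sum_expect_d4_ge_of_window_certificate_TT'_affine₂ 1 ((tp : ℚ) : ℝ) hUr hx0 hx2
    ((κhi : ℚ) : ℝ) ((hi : ℚ) : ℝ) ((κlo : ℚ) : ℝ) ((lo : ℚ) : ℝ) hΛ h8 h0 hz h1 hmul (termOp d TX)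
    (fun σ => ((μ σ : ℚ) : ℝ)) ((ν : ℚ) : ℝ) hΛm O Finset.univ Bsem Finset.univ γ
    (fun l _ => hγS l) wv hsh Ysem Finset.univ bsem cwsem hcw' Finset.univ (fun _ => (1 : ℝ)) Vsem Finset.univ
    (resCoeff R) (resWord d R) hcert hLs hψ hψ1
  -- (6) the price is the engine's `lowerConst`
  have hlc := constCoeff_sub_sum_norm_resCoeff R
  have hμ : (∑ σ : Fin 2, ((μ σ : ℚ) : ℝ)) = ((μ 0 : ℚ) : ℝ) + ((μ 1 : ℚ) : ℝ) := Fin.sum_univ_two _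
  have e2 : (((μ 0 : ℚ) : ℝ) + ((μ 1 : ℚ) : ℝ)) * (x / 2 - ((ν : ℚ) : ℝ)) =
      (((μ 0 : ℚ) : ℝ) + ((μ 1 : ℚ) : ℝ)) * (((n₀ : ℚ) : ℝ) / 2 - ((ν : ℚ) : ℝ)) +
        (((μ 0 : ℚ) : ℝ) + ((μ 1 : ℚ) : ℝ)) / 2 * (x - ((n₀ : ℚ) : ℝ)) := by
    ring
  rw [hμ, e2, hlc] at hmain
  have hq' : ((q : ℚ) : ℝ) ≤ ((lowerConst R : ℚ) : ℝ) +
      (((μ 0 : ℚ) : ℝ) + ((μ 1 : ℚ) : ℝ)) * (((n₀ : ℚ) : ℝ) / 2 - ((ν : ℚ) : ℝ)) := by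
    have h2 : ((q : ℚ) : ℝ) ≤ (((lowerConst R + (μ 0 + μ 1) * (n₀ / 2 - ν) : ℚ)) : ℝ) := by exact_mod_cast hq
    push_cast at h2
    linarith
  have hs' : ((s : ℚ) : ℝ) = (((μ 0 : ℚ) : ℝ) + ((μ 1 : ℚ) : ℝ)) / 2 := by
    rw [hs]; push_cast; ring
  rw [hs']
  linarith


/-- **KERNEL FORM, TWO-LEVEL GRAM: the symmetry-adapted instance** — Gram family `gramTB K blocks` (PSD by construction, no positivity
test), every other datum as in `affineOrbitLowerRowN_of_kernelCert`; the ONLY per-certificate obligation is the decidable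
`q ≤ lowerConst (normalize enc B (residTG … (gramTB K blocks) …)) + (μ 0 + μ 1)(n₀/2 − ν)`. [cite: WangEtAl2024, §III]
[cite: JanssonChaykinKeil2008, §3] -/
theorem affineOrbitLowerRowN_of_kernelCertTB
    (tp U : ℚ) (hU : 0 ≤ U)
    {Λ Λ' : Finset (Site 2)} (hΛ : Λ ⊆ Λ') (h8 : thicken Λ 1 ⊆ Λ')
    (h0 : thicken ({0} : Finset (Site 2)) 1 ⊆ Λ') (hz : (0 : Site 2) ∈ Λ')
    {S : Finset (DihedralGroup 4)} (h1 : (1 : DihedralGroup 4) ∈ S) (hmul : ∀ a ∈ S, ∀ b ∈ S, a * b ∈ S)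
    -- letters
    (d : α → Orb (PolySite Λ')) (hd : Function.Injective d) (enc : α → ℕ) (Bkey : ℕ)
    (dΛ : β → Orb (PolySite Λ)) (f : β → α) (hf : ∀ b, d (f b) = Orb.embMap (PolySite.incl hΛ) (dΛ b))
    (sp : α → Fin 2) (hsp : ∀ a, (ofLex (d a)).2 = sp a)
    -- dictionaries
    (TH : Terms α) (hH : termOp d TH = (hubbardTTPrimeFermionInteraction 1 tp U).localHamiltonian Λ')
    (TE : Terms α)
    (hE : termOp d TE = fermionEmbed (PolySite.incl h0) ((hubbardTTPrimeFermionInteraction 1 tp U).meanEnergyObs 1))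
    (o : Fin 2 → α) (ho : ∀ σ, d (o σ) = orb (PolySite.pt 0 hz) σ)
    -- certificate data
    (TX : Terms α) (μ : Fin 2 → ℚ) (ν κhi hi κlo lo : ℚ) (K : ℕ) (blocks : List (List (List ℤ × Terms α)))
    (EB : List (Terms β))
    {nS : ℕ} (γ : Fin nS → DihedralGroup 4) (hγS : ∀ l, γ l ∈ S) (wv : Fin nS → Site 2)
    (hsh : ∀ l, d4ShiftSet (γ l) (wv l) Λ ⊆ Λ') (g : Fin nS → β → α)
    (hg : ∀ l b, d (g l b) = Orb.embMap (PolySite.incl (hsh l)) (Orb.embMap (PolySite.d4Emb (γ l) (wv l) Λ) (dΛ b)))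
    (SY : Fin nS → Terms β)
    (CW : Terms α) (hcw : ∀ wc ∈ CW, chargeW wc.1 ≠ 0 ∨ spinChargeW sp wc.1 ≠ 0)
    (AV : List (Terms α))
    -- the ONE rational inequality
    {q s n₀ : ℚ} (hs : s = (μ 0 + μ 1) / 2)
    (hq : q ≤ lowerConst (CARPoly.normalize enc Bkey
      (residTG TX μ ν o κhi hi κlo lo TE (gramTB K blocks) TH f EB g SY CW AV)) + (μ 0 + μ 1) * (n₀ / 2 - ν)) :
    SquareTTPrimeCorrAffineOrbitLowerRowN (tp : ℝ) (U : ℝ) q hi lo κhi κlo s n₀ S Λ' (termOp d TX) :=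
  affineOrbitLowerRowN_of_kernelCertG tp U hU hΛ h8 h0 hz h1 hmul d hd enc Bkey dΛ f hf sp hsp TH hH TE hE o ho TX μ ν κhi hi
    κlo lo (gramTB K blocks) (gramTBCoef_posSemidef K blocks) (gramTBOp d blocks) (termOp_gramTB_eq_gramForm d K blocks) EB γ
    hγS wv hsh g hg SY CW hcw AV hs hq

end KernelForm

end CARPolyWindow

end Summit.Ventures.CertifiedManyBodySolver

end
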